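import Summits.HodgeConjecture.HodgeConjecture.Theorems.Ring2AbelianAllFermatQuotientCharactersSixfolds
import HarnessLib

/-!
# Fermat-quotient characters of NEW non-simple NON-SPLIT metacyclic habitats over bases of genus ≥ 1 — GenusTwoSurface (WEIL-2 gen 33, FERMAT-G33 §3 TABLE Q; fact-free core)

research route, not a corollary; conditional on HC_CM plus one named minimal statement.

Cell `pub-hodge-ring2-ab-*` (ALL ABELIAN VARIETIES), seat WEIL-2 gen 33, account
`run/shared/lean/pub/pub-hodge-ring2/pub-hodge-ring2-ab-weil-2/FERMAT-G33.md` §3 (TABLE Q FINAL: kit jobs j178586 / j179270, scan `code/g32/meta_q/`,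
harvest with the column `e = gcd(f, X-data)` `code/g33/meta_q/harvest_q2.py`), building on FERMAT-G32 §2 THEOREM F_q (base genus `q`, hypothesis
(H): `e = 1`) — SOUND / referee-re-derived (ab-ref R-120).

Informal setting (not formalised; the geometry has no carriers here).  For a metacyclic Galois cover `C̃ → ℙ¹` with group `ℤ/f ⋊ ⟨u⟩` (`⟨u⟩ =
Gal(ℚ(ζ_f)/K)`-part) and `t` branch points of `H`-type, the `N = ℤ/f`-quotient `X = C̃/N` is a curve of genus `q ≥ 1`; THEOREM F_q applied to the
cyclic cover `C̃ → X` (exponent multiset `α` = «X-data», `b` entries, `e = gcd(f, α) = 1` for every type in THIS file) says that Weil's structure on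
the `N`-primitive Prym is generated by algebraic cycles as soon as `α` is a cycle character of the Fermat variety `X^{b−2}_f`, and then `W_K` of the
Hecke `K`-piece is algebraic (gen 5 Cor D.1, FERMAT-G31 LEMMA 3.2).  Listed: the X-data of the types found NON-SIMPLE, `E`-balanced, with a NON-SPLIT
`(n,n)` `K`-piece — each (i) a Hodge multiset and (ii) in every `IsShiodaClosed` family (explicit pair / Lefschetz 4-set / semi 6-set / juxtaposition
term, or the tree's kernel-checked `(P_f)` where the scan's witness uses a type-I step).  Statements already in the tree (the same multiset occurs as
a sphere type of TABLE M or a (3,3) type) are not repeated.  Helpers `star_eq` / `pair_eq` from `Ring2AbelianAllFermatQuotientCharactersSixfolds`.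
0 sorry, no `def`, no named fact; `HC_CM` does not occur.  All proofs are `decide` on explicit finite data.
-/

open Multiset
open Literature.AlgebraicGeometry.HodgeTheory.FermatCharacter
open Summit.HodgeConjecture.Ring2AbelianAll.FermatQuotientCharactersSixfolds (star_eq pair_eq)

namespace Summit.HodgeConjecture.Ring2AbelianAll.FermatQuotientCharactersGenusTwoSurface

/-- `[1^1 5^1 9^2]`, `m = 12`: a Hodge multiset — a Hodge character of the Fermat variety `X^2_12` (`b = 4`) for `α` and its unit multiples
(⟺ Weil type `(3,3)`, Schoen Cor. 1.9).  ℚ(i): G = ℤ/12 ⋊ ⟨5⟩ cover of ℙ¹ with 8 branch points, e.g. [x^1, x^9, s5, x^2s5, x^2s5, x^2s5, x^2s5, x^10s5] (genus 33; 3 structures); X = C̃/N of genus q = 2 (t = 6 H-type points), b = 4; K-piece (3,3), class -[3] (NON-SPLIT); data non-simple, e = gcd(f, X-data) = 1 (hypothesis (H)); family dimension 5 (FERMAT-G33 §3 TABLE Q, kit j179270).  [locator FERMAT-G33 §3 TABLE Q]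
research route, not a corollary; conditional on HC_CM plus one named minimal statement. -/
theorem isHodgeMultiset_1_5_9_9 : IsHodgeMultiset ({1, 5, 9, 9} : Multiset (ZMod 12)) := by
  unfold IsHodgeMultiset mNormSum; decide

/-- `[1^1 5^1 9^2]`, `m = 12`: in every `IsShiodaClosed` family via `surface[1, 5, 9, 9]` — with `C = 𝔈_12`: the eigenlines `V(tα) ⊂ H^2(X^2_12; ℂ)` are
algebraic granted Shioda 1979 Thm II c)/§4 Lemma 1 and Lefschetz (1,1) (no `(P_12)`); THEOREM F_2's cycle input for this habitat (FERMAT-G32 §2 (e)).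
[locator FERMAT-G33 §3 TABLE Q]  research route, not a corollary; conditional on HC_CM plus one named minimal statement. -/
theorem mem_of_isShiodaClosed_1_5_9_9 {C : Multiset (ZMod 12) → Prop} (hC : IsShiodaClosed C) :
    C ({1, 5, 9, 9} : Multiset (ZMod 12)) :=
  (hC.surface {1, 5, 9, 9} (by unfold IsHodgeMultiset mNormSum; decide) (by decide))

/-- `[3^2 7^1 11^1]`, `m = 12`: a Hodge multiset — a Hodge character of the Fermat variety `X^2_12` (`b = 4`) for `α` and its unit multiples
(⟺ Weil type `(3,3)`, Schoen Cor. 1.9).  ℚ(i): G = ℤ/12 ⋊ ⟨5⟩ cover of ℙ¹ with 8 branch points, e.g. [x^3, x^7, s5, s5, s5, x^2s5, x^2s5, x^10s5] (genus 33; 3 structures); X = C̃/N of genus q = 2 (t = 6 H-type points), b = 4; K-piece (3,3), class -[3] (NON-SPLIT); data non-simple, e = gcd(f, X-data) = 1 (hypothesis (H)); family dimension 5 (FERMAT-G33 §3 TABLE Q, kit j179270).  [locator FERMAT-G33 §3 TABLE Q]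
research route, not a corollary; conditional on HC_CM plus one named minimal statement. -/
theorem isHodgeMultiset_3_3_7_11 : IsHodgeMultiset ({3, 3, 7, 11} : Multiset (ZMod 12)) := by
  unfold IsHodgeMultiset mNormSum; decide

/-- `[3^2 7^1 11^1]`, `m = 12`: in every `IsShiodaClosed` family via `surface[3, 3, 7, 11]` — with `C = 𝔈_12`: the eigenlines `V(tα) ⊂ H^2(X^2_12; ℂ)` are
algebraic granted Shioda 1979 Thm II c)/§4 Lemma 1 and Lefschetz (1,1) (no `(P_12)`); THEOREM F_2's cycle input for this habitat (FERMAT-G32 §2 (e)).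
[locator FERMAT-G33 §3 TABLE Q]  research route, not a corollary; conditional on HC_CM plus one named minimal statement. -/
theorem mem_of_isShiodaClosed_3_3_7_11 {C : Multiset (ZMod 12) → Prop} (hC : IsShiodaClosed C) :
    C ({3, 3, 7, 11} : Multiset (ZMod 12)) :=
  (hC.surface {3, 3, 7, 11} (by unfold IsHodgeMultiset mNormSum; decide) (by decide))

/-- `[1^1 7^1 8^2]`, `m = 12`: a Hodge multiset — a Hodge character of the Fermat variety `X^2_12` (`b = 4`) for `α` and its unit multiples
(⟺ Weil type `(3,3)`, Schoen Cor. 1.9).  ℚ(√−3): G = ℤ/12 ⋊ ⟨7⟩ cover of ℙ¹ with 8 branch points, e.g. [x^1, x^8, s7, s7, s7, s7, s7, x^9s7] (genus 32; 7 structures); X = C̃/N of genus q = 2 (t = 6 H-type points), b = 4; K-piece (3,3), class -[2] (NON-SPLIT); data non-simple, e = gcd(f, X-data) = 1 (hypothesis (H)); family dimension 5 (FERMAT-G33 §3 TABLE Q, kit j179270).  [locator FERMAT-G33 §3 TABLE Q]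
research route, not a corollary; conditional on HC_CM plus one named minimal statement. -/
theorem isHodgeMultiset_1_7_8_8 : IsHodgeMultiset ({1, 7, 8, 8} : Multiset (ZMod 12)) := by
  unfold IsHodgeMultiset mNormSum; decide

/-- `[1^1 7^1 8^2]`, `m = 12`: in every `IsShiodaClosed` family via `surface[1, 7, 8, 8]` — with `C = 𝔈_12`: the eigenlines `V(tα) ⊂ H^2(X^2_12; ℂ)` are
algebraic granted Shioda 1979 Thm II c)/§4 Lemma 1 and Lefschetz (1,1) (no `(P_12)`); THEOREM F_2's cycle input for this habitat (FERMAT-G32 §2 (e)).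
[locator FERMAT-G33 §3 TABLE Q]  research route, not a corollary; conditional on HC_CM plus one named minimal statement. -/
theorem mem_of_isShiodaClosed_1_7_8_8 {C : Multiset (ZMod 12) → Prop} (hC : IsShiodaClosed C) :
    C ({1, 7, 8, 8} : Multiset (ZMod 12)) :=
  (hC.surface {1, 7, 8, 8} (by unfold IsHodgeMultiset mNormSum; decide) (by decide))

/-- `[4^2 5^1 11^1]`, `m = 12`: a Hodge multiset — a Hodge character of the Fermat variety `X^2_12` (`b = 4`) for `α` and its unit multiples
(⟺ Weil type `(3,3)`, Schoen Cor. 1.9).  ℚ(√−3): G = ℤ/12 ⋊ ⟨7⟩ cover of ℙ¹ with 8 branch points, e.g. [x^4, x^5, s7, s7, s7, s7, s7, x^9s7] (genus 32; 7 structures); X = C̃/N of genus q = 2 (t = 6 H-type points), b = 4; K-piece (3,3), class -[2] (NON-SPLIT); data non-simple, e = gcd(f, X-data) = 1 (hypothesis (H)); family dimension 5 (FERMAT-G33 §3 TABLE Q, kit j179270).  [locator FERMAT-G33 §3 TABLE Q]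
research route, not a corollary; conditional on HC_CM plus one named minimal statement. -/
theorem isHodgeMultiset_4_4_5_11 : IsHodgeMultiset ({4, 4, 5, 11} : Multiset (ZMod 12)) := by
  unfold IsHodgeMultiset mNormSum; decide

/-- `[4^2 5^1 11^1]`, `m = 12`: in every `IsShiodaClosed` family via `surface[4, 4, 5, 11]` — with `C = 𝔈_12`: the eigenlines `V(tα) ⊂ H^2(X^2_12; ℂ)` are
algebraic granted Shioda 1979 Thm II c)/§4 Lemma 1 and Lefschetz (1,1) (no `(P_12)`); THEOREM F_2's cycle input for this habitat (FERMAT-G32 §2 (e)).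
[locator FERMAT-G33 §3 TABLE Q]  research route, not a corollary; conditional on HC_CM plus one named minimal statement. -/
theorem mem_of_isShiodaClosed_4_4_5_11 {C : Multiset (ZMod 12) → Prop} (hC : IsShiodaClosed C) :
    C ({4, 4, 5, 11} : Multiset (ZMod 12)) :=
  (hC.surface {4, 4, 5, 11} (by unfold IsHodgeMultiset mNormSum; decide) (by decide))

end Summit.HodgeConjecture.Ring2AbelianAll.FermatQuotientCharactersGenusTwoSurface
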